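import Mathlib.Algebra.Group.ForwardDiff
import Mathlib.RingTheory.Polynomial.Pochhammer
import Mathlib.Analysis.Complex.ExponentialBounds
import Literature.NumberTheory.DiophantineApproximation.PseudoPolynomials
import Literature.NumberTheory.Transcendental.ZetaLinearFormsCriterion
import HarnessLib

/-!
# The Hall–Ruzsa rigidity theorem for pseudo-polynomials (proof)

Topic `NumberTheory/DiophantineApproximation`. This file DISCHARGES the named fact
`Literature.NumberTheory.DiophantineApproximation.hallRuzsa_polynomial_of_growth_lt` of
`PseudoPolynomials.lean` (Hall, Mathematika 18 (1971); Ruzsa, Mat. Lapok 22 (1971); as stated in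
Delaygue–Rivoal, *On primary pseudo-polynomials*, Int. J. Number Theory 18 (2022) =
arXiv:2102.01534, (1.5) p. 3): *a pseudo-polynomial `(a_n)` with `lim sup |a_n|^{1/n} < e − 1` is a
polynomial.* Everything here is PROVED; no definitions, no named facts.

## The printed proof and how it is mirrored (Delaygue–Rivoal 2022, §1 (1.1)–(1.5) and §2, proof of
Thm. 1 (ii)–(iii), pp. 2–3 and 10 of the arXiv text)

Write `b_n := Δ^n a(0) = ∑_k (−1)^{n−k} C(n,k) a_k` for the binomial transform ((1.2); Mathlib
`fwdDiff_iter_eq_sum_shift`) and `a_n = ∑_k C(n,k) b_k` for its inverse ((1.3); Mathlib's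
Gregory–Newton formula `shift_eq_sum_fwdDiff_iter`).

1. *Hall's criterion (1.4), "only if"*: for a pseudo-polynomial, `d_n = lcm(1,…,n) ∣ b_n`. We prove
   the operator form `m ∣ Δ^m a (j)` for all `j` and `m ≥ 1` by strong induction on `m` from
   Gregory–Newton, `a(j+m) − a(j) = ∑_{1 ≤ i ≤ m} C(m,i) Δ^i a(j)`, using `m ∣ i·C(m,i)`
   (`IsPseudoPolynomial.dvd_fwdDiff_iter_self`); iterating `Δ` gives `m ∣ Δ^n a` for `m ≤ n`, whence
   `d_n ∣ b_n` (`IsPseudoPolynomial.lcmUpto_dvd_natAbs_fwdDiff_iter`, Mathlib `Nat.lcmUpto`).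
2. *Growth of `b_n`* (proof of Thm. 1 (iii)): `|b_n| ≤ ∑_k C(n,k)|a_k| ≤ K(1+θ)^n` when
   `|a_k| ≤ K θ^k` (`abs_fwdDiff_iter_le`).
3. *Prime number theorem step* (proof of Thm. 1 (ii): "`d_n^{1/n} → e`"): the tree's PROVED
   `Literature.NumberTheory.Transcendental.tendsto_log_lcmUpto_div` (`log d_n / n → 1`, from the
   tree's proof of the prime number theorem) gives `K q^n < d_n` for large `n` whenever `q < e`
   (`eventually_mul_pow_lt_lcmUpto`); with `q = 1 + θ < e` and `d_n ∣ b_n` this forces `b_n = 0`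
   for `n ≥ N`.
4. *Polynomiality* ((1.3) and "b_n eventually 0 ⇔ polynomial", p. 2): `a_n = ∑_{k<N} C(n,k) b_k
   = P(n)` with `P = ∑_{k<N} (b_k/k!)·X(X−1)⋯(X−k+1) ∈ ℚ[X]` (Mathlib `descPochhammer`).

The `lim sup` hypothesis is rendered in `hallRuzsa_polynomial_of_growth_lt` as `|a_n| ≤ θ^n` for
`n ≥ n₀` with `θ < e − 1`; step 0 of the main proof turns it into `|a_n| ≤ K θ₁^n` for ALL `n` with
`θ₁ = max θ 1 < e − 1`.

## Design notes

* Iterated differences are written `Δ_[1] ^[n] a` (Mathlib notation `Δ_[h]` from `fwdDiff`, and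
  `f^[n]`); the space before `^[` is needed because a notation imported transitively claims the
  token `]^`.
* The proof lives in this sibling file rather than in `PseudoPolynomials.lean` because it imports
  the tree's prime number theorem (`Literature.NumberTheory.Transcendental.ZetaLinearFormsCriterion`
  and, through it, the `LFunctions` PNT files), which the definitions file should not depend on.

## References

* [DelaygueRivoal2022] É. Delaygue, T. Rivoal, *On primary pseudo-polynomials (Around Ruzsa's
  Conjecture)*, Int. J. Number Theory 18 (2022), arXiv:2102.01534 — (1.1)–(1.5) pp. 2–3; §2 p. 10.
* [HallRR1971PseudoPolynomials] R. R. Hall, *On pseudo-polynomials*, Mathematika 18 (1971) 71–77.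
-/

open Finset Filter Topology fwdDiff

namespace Literature.NumberTheory.DiophantineApproximation

/-! ### Binomial transform and Gregory–Newton over `ℤ` -/

/-- Gregory–Newton formula (Delaygue–Rivoal (1.3)) for an integer sequence:
`a (j + n) = ∑_{k ≤ n} C(n,k) Δ^k a (j)` (Mathlib `shift_eq_sum_fwdDiff_iter`). [folklore] -/
theorem eq_sum_choose_mul_fwdDiff_iter (a : ℕ → ℤ) (n j : ℕ) :
    a (j + n) = ∑ k ∈ range (n + 1), (n.choose k : ℤ) * Δ_[1] ^[k] a j := by
  have h := shift_eq_sum_fwdDiff_iter 1 a n j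
  simp only [nsmul_eq_mul, Nat.cast_id, mul_one] at h
  exact h

/-- The binomial transform (Delaygue–Rivoal (1.2)) as an iterated forward difference:
`Δ^n a (j) = ∑_{k ≤ n} (−1)^{n−k} C(n,k) a (j + k)` (Mathlib `fwdDiff_iter_eq_sum_shift`).
[folklore] -/
theorem fwdDiff_iter_eq_sum_int (a : ℕ → ℤ) (n j : ℕ) :
    Δ_[1] ^[n] a j = ∑ k ∈ range (n + 1), (-1) ^ (n - k) * (n.choose k : ℤ) * a (j + k) := by
  have h := fwdDiff_iter_eq_sum_shift 1 a n j
  simp only [zsmul_eq_mul, Int.cast_id, nsmul_eq_mul, Nat.cast_id, mul_one] at h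
  exact h

/-! ### Hall's criterion (1.4), "only if" direction -/

/-- If every value of `g` is divisible by `m`, so is every value of `Δ^i g`. [folklore] -/
theorem dvd_fwdDiff_iter_of_forall_dvd {g : ℕ → ℤ} {m : ℤ} (hg : ∀ j, m ∣ g j) (i j : ℕ) :
    m ∣ Δ_[1] ^[i] g j := by
  induction i generalizing j with
  | zero => simpa using hg j
  | succ i ih =>
    simp only [Function.iterate_succ_apply', fwdDiff]
    exact dvd_sub (ih _) (ih _)

/-- **Hall's criterion, operator form**: for a pseudo-polynomial `a` and `m ≥ 1`, `m ∣ Δ^m a (j)`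
for every `j`. Strong induction on `m`: by Gregory–Newton
`a(j+m) − a(j) = Δ^m a(j) + ∑_{1 ≤ i < m} C(m,i) Δ^i a(j)`, the left side is divisible by `m`
(pseudo-polynomial), and `C(m,i) Δ^i a(j) = (m C(m−1,i−1)) · (Δ^i a(j)/i)` by induction.
[cite: DelaygueRivoal2022, (1.4) p. 2 (Hall's characterization)] -/
theorem IsPseudoPolynomial.dvd_fwdDiff_iter_self {a : ℕ → ℤ} (ha : IsPseudoPolynomial a) :
    ∀ m j : ℕ, 0 < m → (m : ℤ) ∣ Δ_[1] ^[m] a j := by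
  intro m
  refine Nat.strong_induction_on m ?_
  intro m ih j hm
  obtain ⟨m', rfl⟩ := Nat.exists_eq_add_one_of_ne_zero hm.ne'
  have hGN := eq_sum_choose_mul_fwdDiff_iter a (m' + 1) j
  rw [sum_range_succ, sum_range_succ'] at hGN
  simp only [Nat.choose_self, Nat.choose_zero_right, Nat.cast_one, one_mul,
    Function.iterate_zero_apply] at hGN
  have key : Δ_[1] ^[m' + 1] a j = (a (j + (m' + 1)) - a j) -
      ∑ i ∈ range m', ((m' + 1).choose (i + 1) : ℤ) * Δ_[1] ^[i + 1] a j := by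
    linarith
  rw [key]
  refine dvd_sub (ha j (m' + 1) hm) (dvd_sum fun i hi => ?_)
  have hlt : i + 1 < m' + 1 := by rw [mem_range] at hi; omega
  obtain ⟨q, hq⟩ := ih (i + 1) hlt j (Nat.succ_pos i)
  rw [hq]
  have h' : (((m' + 1).choose (i + 1) : ℕ) : ℤ) * ((i + 1 : ℕ) : ℤ) =
      ((m' + 1 : ℕ) : ℤ) * (m'.choose i : ℤ) := by
    exact_mod_cast (Nat.add_one_mul_choose_eq m' i).symm
  exact ⟨(m'.choose i : ℤ) * q, by linear_combination q * h'⟩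

/-- For a pseudo-polynomial `a` and `1 ≤ m ≤ n`: `m ∣ Δ^n a (j)`. [folklore] -/
theorem IsPseudoPolynomial.dvd_fwdDiff_iter_of_le {a : ℕ → ℤ} (ha : IsPseudoPolynomial a)
    {m n : ℕ} (hm : 0 < m) (hmn : m ≤ n) (j : ℕ) : (m : ℤ) ∣ Δ_[1] ^[n] a j := by
  obtain ⟨i, rfl⟩ := Nat.exists_eq_add_of_le hmn
  rw [add_comm, Function.iterate_add_apply]
  exact dvd_fwdDiff_iter_of_forall_dvd (fun j' => ha.dvd_fwdDiff_iter_self m j' hm) i j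

/-- **Hall's criterion (1.4), "only if"**: for a pseudo-polynomial, `d_n = lcm(1,…,n)` divides the
`n`-th binomial transform `b_n = Δ^n a` (at every point). [cite: DelaygueRivoal2022, (1.4) p. 2] -/
theorem IsPseudoPolynomial.lcmUpto_dvd_natAbs_fwdDiff_iter {a : ℕ → ℤ} (ha : IsPseudoPolynomial a)
    (n j : ℕ) : Nat.lcmUpto n ∣ (Δ_[1] ^[n] a j).natAbs := by
  rw [Nat.lcmUpto, Finset.lcm_dvd_iff]
  intro m hm
  rw [mem_Icc] at hm
  show m ∣ _
  rw [← Int.natCast_dvd]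
  exact ha.dvd_fwdDiff_iter_of_le hm.1 hm.2 j

/-! ### Growth of the binomial transform -/

/-- If `|a_k| ≤ K θ^k` for all `k` then `|b_n| = |Δ^n a(0)| ≤ ∑_k C(n,k)|a_k| ≤ K (1+θ)^n`
(Delaygue–Rivoal, proof of Thm. 1 (iii)).
[cite: DelaygueRivoal2022, §2 proof of Thm. 1 (iii), p. 10] -/
theorem abs_fwdDiff_iter_le {a : ℕ → ℤ} {K θ : ℝ} (ha : ∀ k, |(a k : ℝ)| ≤ K * θ ^ k) (n : ℕ) :
    |((Δ_[1] ^[n] a 0 : ℤ) : ℝ)| ≤ K * (1 + θ) ^ n := by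
  rw [fwdDiff_iter_eq_sum_int]
  push_cast
  simp only [zero_add]
  calc |∑ k ∈ range (n + 1), (-1 : ℝ) ^ (n - k) * (n.choose k : ℝ) * (a k : ℝ)|
      ≤ ∑ k ∈ range (n + 1), |(-1 : ℝ) ^ (n - k) * (n.choose k : ℝ) * (a k : ℝ)| :=
        abs_sum_le_sum_abs _ _
    _ ≤ ∑ k ∈ range (n + 1), (n.choose k : ℝ) * (K * θ ^ k) := by
        refine sum_le_sum fun k _ => ?_
        rw [abs_mul, abs_mul, abs_pow, abs_neg, abs_one, one_pow, one_mul, Nat.abs_cast]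
        exact mul_le_mul_of_nonneg_left (ha k) (Nat.cast_nonneg _)
    _ = K * (1 + θ) ^ n := by
        rw [add_comm (1 : ℝ) θ, add_pow, mul_sum]
        refine sum_congr rfl fun k _ => ?_
        rw [one_pow, mul_one]
        ring

/-! ### The prime number theorem step -/

/-- **`d_n^{1/n} → e`, quantitative consequence**: if `0 < q < e` then `K q^n < lcm(1,…,n)` for all
large `n` — from the tree's proved prime number theorem in the form `log lcm(1,…,n) / n → 1`
(`Literature.NumberTheory.Transcendental.tendsto_log_lcmUpto_div`).
[cite: DelaygueRivoal2022, p. 3 (d_n^{1/n} → e) and §2 proof of Thm. 1 (ii), p. 10] -/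
theorem eventually_mul_pow_lt_lcmUpto {q : ℝ} (hq0 : 0 < q) (hq : q < Real.exp 1) (K : ℝ) :
    ∀ᶠ n : ℕ in atTop, K * q ^ n < (Nat.lcmUpto n : ℝ) := by
  have hlog : Real.log q < 1 := (Real.log_lt_iff_lt_exp hq0).2 hq
  set ε := (1 - Real.log q) / 2 with hε
  have hε0 : 0 < ε := by rw [hε]; linarith
  have h1 : ∀ᶠ n : ℕ in atTop, 1 - ε < Real.log (Nat.lcmUpto n) / n :=
    Literature.NumberTheory.Transcendental.tendsto_log_lcmUpto_div.eventually_const_lt (by linarith)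
  have h2 : ∀ᶠ n : ℕ in atTop, Real.log (max K 1) < ε * n :=
    ((tendsto_natCast_atTop_atTop (R := ℝ)).const_mul_atTop hε0).eventually_gt_atTop _
  filter_upwards [h1, h2, eventually_gt_atTop 0] with n hn1 hn2 hn0
  have hn0' : (0 : ℝ) < n := by exact_mod_cast hn0
  rw [lt_div_iff₀ hn0'] at hn1
  have hL : (0 : ℝ) < Nat.lcmUpto n := by exact_mod_cast Nat.lcmUpto_pos n
  have hK1 : (0 : ℝ) < max K 1 := lt_max_of_lt_right one_pos
  have hlogq : Real.log q = 1 - 2 * ε := by rw [hε]; ring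
  calc K * q ^ n ≤ max K 1 * q ^ n :=
        mul_le_mul_of_nonneg_right (le_max_left _ _) (pow_nonneg hq0.le n)
    _ = Real.exp (Real.log (max K 1) + n * Real.log q) := by
        rw [Real.exp_add, Real.exp_log hK1, ← Real.log_pow, Real.exp_log (pow_pos hq0 n)]
    _ < Real.exp ((1 - ε) * n) := by
        rw [Real.exp_lt_exp, hlogq]
        nlinarith
    _ < Real.exp (Real.log (Nat.lcmUpto n)) := Real.exp_lt_exp.2 hn1
    _ = Nat.lcmUpto n := Real.exp_log hL

/-! ### The theorem -/

/-- **Hall–Ruzsa rigidity theorem** (Hall 1971; Ruzsa 1971; Delaygue–Rivoal 2022, (1.5) and the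
proof of Thm. 1 (ii)–(iii)): DISCHARGE of the named fact `hallRuzsa_polynomial_of_growth_lt` — a
pseudo-polynomial `a` with `|a_n| ≤ θ^n` for `n ≥ n₀`, `θ < e − 1`, is a polynomial:
`a_n = P(n)` for some `P ∈ ℚ[X]`. Proof: `d_n ∣ b_n` (Hall (1.4)), `|b_n| ≤ K(1+θ₁)^n` with
`1 + θ₁ < e`, and `d_n > K(1+θ₁)^n` for large `n` (prime number theorem) force `b_n = 0` for
`n ≥ N`; then Gregory–Newton makes `a_n = ∑_{k<N} b_k C(n,k)` a polynomial.
[cite: DelaygueRivoal2022, (1.5) p. 3 and §2, proof of Thm. 1 (ii)–(iii), p. 10] -/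
theorem hallRuzsa_polynomial_of_growth_lt_holds : hallRuzsa_polynomial_of_growth_lt := by
  rintro a ha ⟨θ, hθe, n₀, hgr⟩
  -- Step 0: `0 ≤ θ` (test the bound at the odd exponent `2 n₀ + 1`) and a bound valid for all `n`.
  have hθ0 : 0 ≤ θ := by
    have h := (abs_nonneg _).trans (hgr (2 * n₀ + 1) (by omega))
    exact (Odd.pow_nonneg_iff (odd_two_mul_add_one n₀)).1 h
  set θ₁ := max θ 1 with hθ₁
  have hθ₁1 : 1 ≤ θ₁ := le_max_right _ _
  have hθθ₁ : θ ≤ θ₁ := le_max_left _ _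
  have hθ₁e : θ₁ < Real.exp 1 - 1 :=
    max_lt hθe (by have := Real.exp_one_gt_d9; linarith)
  set K := 1 + ∑ i ∈ range n₀, |(a i : ℝ)| with hK
  have hS0 : 0 ≤ ∑ i ∈ range n₀, |(a i : ℝ)| := sum_nonneg fun i _ => abs_nonneg _
  have hK1 : 1 ≤ K := by rw [hK]; linarith
  have hbound : ∀ n, |(a n : ℝ)| ≤ K * θ₁ ^ n := by
    intro n
    have hp : 1 ≤ θ₁ ^ n := one_le_pow₀ hθ₁1
    rcases lt_or_ge n n₀ with hn | hn
    · have h1 : |(a n : ℝ)| ≤ ∑ i ∈ range n₀, |(a i : ℝ)| :=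
        single_le_sum (f := fun i => |(a i : ℝ)|) (fun i _ => abs_nonneg _) (mem_range.2 hn)
      calc |(a n : ℝ)| ≤ K := by rw [hK]; linarith
        _ ≤ K * θ₁ ^ n := le_mul_of_one_le_right (by linarith) hp
    · calc |(a n : ℝ)| ≤ θ ^ n := hgr n hn
        _ ≤ θ₁ ^ n := pow_le_pow_left₀ hθ0 hθθ₁ n
        _ ≤ K * θ₁ ^ n := le_mul_of_one_le_left (by positivity) hK1
  -- Step 1–2: `|b_n| ≤ K (1 + θ₁)^n` and `d_n ∣ b_n`; Step 3: `b_n = 0` for `n ≥ N`.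
  have hb : ∀ n, |((Δ_[1] ^[n] a 0 : ℤ) : ℝ)| ≤ K * (1 + θ₁) ^ n :=
    abs_fwdDiff_iter_le hbound
  have hq0 : 0 < 1 + θ₁ := by linarith
  have hqe : 1 + θ₁ < Real.exp 1 := by linarith
  obtain ⟨N, hN⟩ := eventually_atTop.1 (eventually_mul_pow_lt_lcmUpto hq0 hqe K)
  have hzero : ∀ n, N ≤ n → Δ_[1] ^[n] a 0 = 0 := by
    intro n hn
    by_contra hne
    have hdvd : (Nat.lcmUpto n : ℤ) ∣ Δ_[1] ^[n] a 0 :=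
      Int.natCast_dvd.2 (ha.lcmUpto_dvd_natAbs_fwdDiff_iter n 0)
    have hle : (Nat.lcmUpto n : ℤ) ≤ |Δ_[1] ^[n] a 0| :=
      Int.le_of_dvd (abs_pos.2 hne) ((dvd_abs _ _).2 hdvd)
    have hle' : (Nat.lcmUpto n : ℝ) ≤ |((Δ_[1] ^[n] a 0 : ℤ) : ℝ)| := by
      rw [← Int.cast_abs]
      exact_mod_cast hle
    linarith [hN n hn, hb n]
  -- Step 4: `a n = ∑_{k<N} C(n,k) b_k = P(n)` with `P = ∑_{k<N} (b_k/k!) X(X-1)⋯(X-k+1)`.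
  refine ⟨∑ k ∈ range N, Polynomial.C (((Δ_[1] ^[k] a 0 : ℤ) : ℚ) / (k.factorial : ℚ)) *
    descPochhammer ℚ k, fun n => ?_⟩
  rw [Polynomial.eval_finsetSum]
  simp only [Polynomial.eval_mul, Polynomial.eval_C, descPochhammer_eval_eq_descFactorial,
    Nat.descFactorial_eq_factorial_mul_choose, Nat.cast_mul]
  have hGN : (a n : ℚ) = ∑ k ∈ range (n + 1), (n.choose k : ℚ) * ((Δ_[1] ^[k] a 0 : ℤ) : ℚ) := by
    have h := congrArg (Int.cast : ℤ → ℚ) (eq_sum_choose_mul_fwdDiff_iter a n 0)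
    push_cast at h
    simpa only [zero_add] using h
  rw [hGN]
  have hS : range (n + 1) ⊆ range (n + 1 + N) := range_subset_range.2 (by omega)
  have hS' : range N ⊆ range (n + 1 + N) := range_subset_range.2 (by omega)
  have e1 : ∑ k ∈ range (n + 1), (n.choose k : ℚ) * ((Δ_[1] ^[k] a 0 : ℤ) : ℚ) =
      ∑ k ∈ range (n + 1 + N), (n.choose k : ℚ) * ((Δ_[1] ^[k] a 0 : ℤ) : ℚ) := by
    refine sum_subset hS fun k _ hk => ?_
    rw [mem_range, not_lt] at hk
    rw [Nat.choose_eq_zero_of_lt (by omega : n < k), Nat.cast_zero, zero_mul]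
  have e2 : ∑ k ∈ range N, ((Δ_[1] ^[k] a 0 : ℤ) : ℚ) / (k.factorial : ℚ) *
        ((k.factorial : ℚ) * (n.choose k : ℚ)) =
      ∑ k ∈ range (n + 1 + N), (n.choose k : ℚ) * ((Δ_[1] ^[k] a 0 : ℤ) : ℚ) := by
    rw [← sum_subset hS' ?_]
    · refine sum_congr rfl fun k _ => ?_
      have hk : (k.factorial : ℚ) ≠ 0 := by exact_mod_cast k.factorial_ne_zero
      rw [← mul_assoc, div_mul_cancel₀ _ hk, mul_comm]
    · intro k _ hk
      rw [mem_range, not_lt] at hk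
      rw [hzero k hk, Int.cast_zero, mul_zero]
  rw [e1, e2]

/-!
## Primary pseudo-polynomials: Delaygue–Rivoal 2022, Theorem 1 (iii)

This section DISCHARGES the named fact `delaygueRivoal2022_thm1_iii` of `PseudoPolynomials.lean`
(É. Delaygue, T. Rivoal, *On primary pseudo-polynomials (Around Ruzsa's Conjecture)*, Int. J.
Number Theory 18 (2022) = arXiv:2102.01534, **Theorem 1 (iii)** p. 5, proof §2 pp. 9–10): *a
PRIMARY pseudo-polynomial (`a(n+p) ≡ a(n) (mod p)` for all `n` and all PRIMES `p` only) with
`lim sup |a_n|^{1/n} < e − 1` is a polynomial.* The proof is the one printed in §2 of the paper; it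
runs exactly like the Hall–Ruzsa argument above with `d_n = lcm(1,…,n)` replaced by the primorial
`P_n = ∏_{p ≤ n} p` (paper p. 5):

* *(i), "only if"* (pp. 9–10): every prime `p ≤ n` divides `b_n = Δ^n a(0)`, hence `P_n ∣ b_n`
  (`IsPrimaryPseudoPolynomial.primorial_dvd_natAbs_fwdDiff_iter`). DEVIATION (a shorter road than
  the Lucas-congruence computation printed there): `Δ^n = Δ^{n−p} ∘ Δ^p` and
  `Δ^p a(m) = ∑_k (−1)^{p−k} C(p,k) a(m+k) ≡ a(m+p) + (−1)^p a(m) = (a(m+p) − a(m)) + (1 + (−1)^p) a(m) ≡ 0 (mod p)`,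
  because `p ∣ C(p,k)` for `0 < k < p` and `p ∣ 1 + (−1)^p`
  (`IsPrimaryPseudoPolynomial.prime_dvd_fwdDiff_iter_prime`, `…_of_le`).
* *(iii)* (p. 10): `|b_n| ≤ ∑_k C(n,k)|a_k| ≤ K (1 + θ₁)^n` (`abs_fwdDiff_iter_le` above), `1 + θ₁ < e`.
* *(ii)* (p. 10: "`P_n^{1/n} → e` as `n → +∞`"): the prime number theorem for `ϑ(n) = log P_n`
  (the tree's proved `Literature.NumberTheory.LFunctions.chebyshevTheta_isEquivalent`, `ϑ(x) ~ x`,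
  and Mathlib `Chebyshev.theta_eq_log_primorial`) gives `K q^n < P_n` for large `n` when `q < e`
  (`eventually_mul_pow_lt_primorial`); with `P_n ∣ b_n` this forces `b_n = 0` for `n ≥ N`.
* *Conclusion* (pp. 2–3, "`b_n = 0` for all large `n`" ⟺ "`a_n = P(n)`, `P ∈ ℚ[X]`"):
  `a_n = ∑_{k<N} C(n,k) b_k = P(n)` with `P = ∑_{k<N} (b_k/k!) X(X−1)⋯(X−k+1)`
  (`exists_ratPolynomial_of_fwdDiff_iter_eq_zero`, Mathlib `Nat.cast_choose_eq_descPochhammer_div`).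

[cite: DelaygueRivoal2022, Thm. 1 (iii) (p. 5); §2 (pp. 9–10)]
-/

/-! ### Theorem 1 (i), "only if": primes and the primorial divide the binomial transform -/

/-- For a primary pseudo-polynomial `a` and a prime `p`: `p ∣ Δ^p a (m)` for every `m`, because
`Δ^p a(m) = ∑_k (−1)^{p−k} C(p,k) a(m+k) ≡ a(m+p) + (−1)^p a(m) (mod p)` (`p ∣ C(p,k)`, `0 < k < p`)
and `a(m+p) + (−1)^p a(m) = (a(m+p) − a(m)) + (1 + (−1)^p) a(m)` with `p ∣ 1 + (−1)^p`.
[cite: DelaygueRivoal2022, §2 proof of Thm. 1 (i), pp. 9–10 (forward-difference variant)] -/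
theorem IsPrimaryPseudoPolynomial.prime_dvd_fwdDiff_iter_prime {a : ℕ → ℤ}
    (ha : IsPrimaryPseudoPolynomial a) {p : ℕ} (hp : p.Prime) (m : ℕ) :
    (p : ℤ) ∣ Δ_[1] ^[p] a m := by
  rw [fwdDiff_iter_eq_sum_shift]
  obtain ⟨q, rfl⟩ : ∃ q, p = q + 1 := ⟨p - 1, (Nat.sub_add_cancel hp.one_le).symm⟩
  rw [sum_range_succ, sum_range_succ', add_assoc]
  refine dvd_add (dvd_sum fun k hk => ?_) ?_
  · -- middle terms: `p ∣ C(p, k+1)` for `0 < k + 1 < p`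
    have hk' : k + 1 < q + 1 := by rw [mem_range] at hk; omega
    have hdvd : ((q + 1 : ℕ) : ℤ) ∣ (((q + 1).choose (k + 1) : ℕ) : ℤ) :=
      Int.natCast_dvd_natCast.2 (hp.dvd_choose_self (Nat.succ_ne_zero k) hk')
    rw [smul_eq_mul]
    exact (hdvd.mul_left _).mul_right _
  · -- end terms `k = 0` and `k = p`
    have h1 : ((q + 1 : ℕ) : ℤ) ∣ (-1) ^ (q + 1) + 1 := by
      rcases hp.eq_two_or_odd' with h2 | hodd
      · rw [h2]; decide
      · rw [hodd.neg_one_pow]; simp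
    have h2 := ha m (q + 1) hp
    have key : ((-1 : ℤ) ^ (q + 1 - 0) * ((q + 1).choose 0 : ℕ)) • a (m + 0 • (1 : ℕ)) +
        ((-1 : ℤ) ^ (q + 1 - (q + 1)) * ((q + 1).choose (q + 1) : ℕ)) • a (m + (q + 1) • (1 : ℕ)) =
        (a (m + (q + 1)) - a m) + ((-1) ^ (q + 1) + 1) * a m := by
      simp only [Nat.sub_zero, Nat.choose_zero_right, Nat.cast_one, mul_one, add_zero,
        Nat.sub_self, pow_zero, Nat.choose_self, smul_eq_mul, one_mul]
      ring
    rw [key]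
    exact dvd_add h2 (h1.mul_right _)

/-- Hence `p ∣ Δ^n a (m)` for all `n ≥ p` and all `m` (`Δ^n = Δ^{n−p} ∘ Δ^p`,
`dvd_fwdDiff_iter_of_forall_dvd`); in particular `p ∣ b_n` for `n ≥ p`, which is the "only if" half
of the equivalence used on p. 11 of the paper ("for all `n ≥ 0`, `a_{n+p} ≡ a_n mod p`" ⟺ "for all
`n ≥ p`, `p` divides `b_n`"). [cite: DelaygueRivoal2022, §2 proof of Thm. 1 (i), p. 10] -/
theorem IsPrimaryPseudoPolynomial.prime_dvd_fwdDiff_iter_of_le {a : ℕ → ℤ}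
    (ha : IsPrimaryPseudoPolynomial a) {p n : ℕ} (hp : p.Prime) (hpn : p ≤ n) (m : ℕ) :
    (p : ℤ) ∣ Δ_[1] ^[n] a m := by
  obtain ⟨i, rfl⟩ := Nat.exists_eq_add_of_le hpn
  rw [add_comm, Function.iterate_add_apply]
  exact dvd_fwdDiff_iter_of_forall_dvd (fun j => ha.prime_dvd_fwdDiff_iter_prime hp j) i m

/-- **Theorem 1 (i) of Delaygue–Rivoal, "only if"**: for a primary pseudo-polynomial the primorial
`P_n = ∏_{p ≤ n} p` divides the `n`-th binomial transform `b_n = Δ^n a` (at every point).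
[cite: DelaygueRivoal2022, Thm. 1 (i) (1.8) p. 5, proof §2 pp. 9–10] -/
theorem IsPrimaryPseudoPolynomial.primorial_dvd_natAbs_fwdDiff_iter {a : ℕ → ℤ}
    (ha : IsPrimaryPseudoPolynomial a) (n m : ℕ) : primorial n ∣ (Δ_[1] ^[n] a m).natAbs := by
  rw [primorial]
  refine Finset.prod_primes_dvd _ (fun p hp => Nat.prime_iff.1 (mem_filter.1 hp).2)
    (fun p hp => ?_)
  obtain ⟨hpr, hpp⟩ := mem_filter.1 hp
  exact Int.natCast_dvd.1
    (ha.prime_dvd_fwdDiff_iter_of_le hpp (Nat.lt_succ_iff.1 (mem_range.1 hpr)) m)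

/-! ### The prime number theorem step for the primorial -/

/-- **`P_n^{1/n} → e`, quantitative consequence**: if `0 < q < e` then `K q^n < P_n = ∏_{p ≤ n} p`
for all large `n` — from the tree's proved prime number theorem `ϑ(x) ~ x`
(`Literature.NumberTheory.LFunctions.chebyshevTheta_isEquivalent`) and `ϑ(n) = log P_n`
(Mathlib `Chebyshev.theta_eq_log_primorial`).
[cite: DelaygueRivoal2022, p. 5 (P_n^{1/n} → e) and §2 proof of Thm. 1 (ii), p. 10] -/
theorem eventually_mul_pow_lt_primorial {q : ℝ} (hq0 : 0 < q) (hq : q < Real.exp 1) (K : ℝ) :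
    ∀ᶠ n : ℕ in atTop, K * q ^ n < (primorial n : ℝ) := by
  have hlog : Real.log q < 1 := (Real.log_lt_iff_lt_exp hq0).2 hq
  set c : ℝ := (1 - Real.log q) / 2 with hc
  have hc0 : 0 < c := by rw [hc]; linarith
  -- `|ϑ(x) - x| ≤ c x` for large real `x`, hence `(1 - c) n ≤ log P_n` for large `n`
  have h1 : ∀ᶠ x : ℝ in atTop, ‖Chebyshev.theta x - x‖ ≤ c * ‖x‖ :=
    Literature.NumberTheory.LFunctions.chebyshevTheta_isEquivalent.isLittleO.def hc0
  have h2 : ∀ᶠ n : ℕ in atTop, (1 - c) * n ≤ Real.log (primorial n) := by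
    filter_upwards [tendsto_natCast_atTop_atTop.eventually h1] with n hn
    rw [Real.norm_eq_abs, Real.norm_eq_abs, Nat.abs_cast] at hn
    have hθn : Real.log (primorial n) = Chebyshev.theta n := by
      rw [Chebyshev.theta_eq_log_primorial, Nat.floor_natCast]
    rw [hθn]
    linarith [(abs_le.1 hn).1]
  have h3 : ∀ᶠ n : ℕ in atTop, Real.log (max K 1) < c * n := by
    filter_upwards [tendsto_natCast_atTop_atTop.eventually_gt_atTop (Real.log (max K 1) / c)]
      with n hn
    rw [div_lt_iff₀ hc0] at hn
    linarith
  filter_upwards [h2, h3] with n h2 h3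
  have hpos : (0 : ℝ) < primorial n := by exact_mod_cast primorial_pos n
  have hK1 : (0 : ℝ) < max K 1 := lt_max_of_lt_right one_pos
  calc K * q ^ n ≤ max K 1 * q ^ n :=
        mul_le_mul_of_nonneg_right (le_max_left _ _) (pow_nonneg hq0.le n)
    _ < primorial n := by
        rw [← Real.log_lt_log_iff (by positivity) hpos, Real.log_mul hK1.ne' (pow_pos hq0 n).ne',
          Real.log_pow]
        have h4 : (1 - c) * n = n * Real.log q + c * n := by rw [hc]; ring
        linarith

/-! ### Eventually vanishing binomial transform means polynomial -/

/-- If `b_k = Δ^k a(0) = 0` for all `k ≥ N`, then `a_n = P(n)` for the polynomial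
`P = ∑_{k<N} (b_k / k!) · X(X−1)⋯(X−k+1) ∈ ℚ[X]`: by Gregory–Newton `a_n = ∑_{k ≤ n} C(n,k) b_k`,
and both this sum and `∑_{k<N} C(n,k) b_k` agree with the sum over `k < max (n+1) N`
(`C(n,k) = 0` for `k > n`, `b_k = 0` for `k ≥ N`). [cite: DelaygueRivoal2022, pp. 2–3 (binomial
transform eventually zero ⟺ polynomial)] -/
theorem exists_ratPolynomial_of_fwdDiff_iter_eq_zero (a : ℕ → ℤ) (N : ℕ)
    (hN : ∀ k ≥ N, Δ_[1] ^[k] a 0 = 0) :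
    ∃ P : Polynomial ℚ, ∀ n : ℕ, (a n : ℚ) = P.eval (n : ℚ) := by
  refine ⟨∑ k ∈ range N, Polynomial.C (((Δ_[1] ^[k] a 0 : ℤ) : ℚ) / k.factorial) *
    descPochhammer ℚ k, fun n => ?_⟩
  -- Gregory–Newton: `a n = ∑_{k ≤ n} C(n,k) b_k`
  have h1 : a n = ∑ k ∈ range (n + 1), (n.choose k : ℤ) * Δ_[1] ^[k] a 0 := by
    have := shift_eq_sum_fwdDiff_iter 1 a n 0
    simpa using this
  -- both `∑_{k ≤ n}` and `∑_{k < N}` equal the sum over `k < max (n+1) N`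
  have h2 : ∑ k ∈ range (n + 1), (n.choose k : ℤ) * Δ_[1] ^[k] a 0 =
      ∑ k ∈ range N, (n.choose k : ℤ) * Δ_[1] ^[k] a 0 := by
    have hA : ∑ k ∈ range (n + 1), (n.choose k : ℤ) * Δ_[1] ^[k] a 0 =
        ∑ k ∈ range (max (n + 1) N), (n.choose k : ℤ) * Δ_[1] ^[k] a 0 := by
      refine sum_subset (range_subset_range.2 (le_max_left _ _)) fun k _ hk => ?_
      rw [mem_range, not_lt] at hk
      rw [Nat.choose_eq_zero_of_lt (by omega), Nat.cast_zero, zero_mul]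
    have hB : ∑ k ∈ range N, (n.choose k : ℤ) * Δ_[1] ^[k] a 0 =
        ∑ k ∈ range (max (n + 1) N), (n.choose k : ℤ) * Δ_[1] ^[k] a 0 := by
      refine sum_subset (range_subset_range.2 (le_max_right _ _)) fun k _ hk => ?_
      rw [mem_range, not_lt] at hk
      rw [hN k hk, mul_zero]
    rw [hA, hB]
  rw [h1, h2]
  push_cast
  rw [Polynomial.eval_finsetSum]
  refine sum_congr rfl fun k _ => ?_
  rw [Polynomial.eval_mul, Polynomial.eval_C, Nat.cast_choose_eq_descPochhammer_div]
  ring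

/-! ### Theorem 1 (iii) -/

/-- **Delaygue–Rivoal 2022, Theorem 1 (iii)** — DISCHARGE of the named fact
`delaygueRivoal2022_thm1_iii`: a primary pseudo-polynomial `a` with `|a_n| ≤ θ^n` for `n ≥ n₀`,
`θ < e − 1`, is a polynomial (`a_n = P(n)`, `P ∈ ℚ[X]`). Proof as printed in §2 of the paper:
`P_n ∣ b_n` (Thm. 1 (i), `IsPrimaryPseudoPolynomial.primorial_dvd_natAbs_fwdDiff_iter`),
`|b_n| ≤ K(1+θ₁)^n` with `θ₁ = max θ 1`, `1 + θ₁ < e` (`abs_fwdDiff_iter_le`), and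
`P_n > K(1+θ₁)^n` for large `n` by the prime number theorem (`eventually_mul_pow_lt_primorial`);
so `b_n = 0` for `n ≥ N` and `a` is a polynomial (`exists_ratPolynomial_of_fwdDiff_iter_eq_zero`).
A negative `θ` is excluded by the hypothesis at the odd index `2 n₀ + 1`.
[cite: DelaygueRivoal2022, Thm. 1 (iii) (p. 5); proof §2 (p. 10)] -/
theorem delaygueRivoal2022_thm1_iii_holds : delaygueRivoal2022_thm1_iii := by
  rintro a ha ⟨θ, hθe, n₀, hgr⟩
  -- Step 0: `0 ≤ θ`, and a bound `|a n| ≤ K θ₁^n` valid for ALL `n`, `θ₁ = max θ 1 < e - 1`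
  have hθ0 : 0 ≤ θ := by
    have h := (abs_nonneg _).trans (hgr (2 * n₀ + 1) (by omega))
    exact (Odd.pow_nonneg_iff (odd_two_mul_add_one n₀)).1 h
  set θ₁ := max θ 1 with hθ₁
  have hθ₁1 : 1 ≤ θ₁ := le_max_right _ _
  have hθθ₁ : θ ≤ θ₁ := le_max_left _ _
  have hθ₁e : θ₁ < Real.exp 1 - 1 :=
    max_lt hθe (by have := Real.exp_one_gt_d9; linarith)
  set K := 1 + ∑ i ∈ range n₀, |(a i : ℝ)| with hK
  have hS0 : 0 ≤ ∑ i ∈ range n₀, |(a i : ℝ)| := sum_nonneg fun i _ => abs_nonneg _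
  have hK1 : 1 ≤ K := by rw [hK]; linarith
  have hbound : ∀ n, |(a n : ℝ)| ≤ K * θ₁ ^ n := by
    intro n
    have hp : 1 ≤ θ₁ ^ n := one_le_pow₀ hθ₁1
    rcases lt_or_ge n n₀ with hn | hn
    · have h1 : |(a n : ℝ)| ≤ ∑ i ∈ range n₀, |(a i : ℝ)| :=
        single_le_sum (f := fun i => |(a i : ℝ)|) (fun i _ => abs_nonneg _) (mem_range.2 hn)
      calc |(a n : ℝ)| ≤ K := by rw [hK]; linarith
        _ ≤ K * θ₁ ^ n := le_mul_of_one_le_right (by linarith) hp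
    · calc |(a n : ℝ)| ≤ θ ^ n := hgr n hn
        _ ≤ θ₁ ^ n := pow_le_pow_left₀ hθ0 hθθ₁ n
        _ ≤ K * θ₁ ^ n := le_mul_of_one_le_left (by positivity) hK1
  -- (iii) `|b_n| ≤ K (1 + θ₁)^n`; (ii) `P_n > K (1 + θ₁)^n` for `n ≥ N`; (i) `P_n ∣ b_n`: so `b_n = 0`
  have hb : ∀ n, |((Δ_[1] ^[n] a 0 : ℤ) : ℝ)| ≤ K * (1 + θ₁) ^ n :=
    abs_fwdDiff_iter_le hbound
  have hq0 : 0 < 1 + θ₁ := by linarith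
  have hqe : 1 + θ₁ < Real.exp 1 := by linarith
  obtain ⟨N, hN⟩ := eventually_atTop.1 (eventually_mul_pow_lt_primorial hq0 hqe K)
  have hzero : ∀ n ≥ N, Δ_[1] ^[n] a 0 = 0 := by
    intro n hn
    by_contra hne
    have h1 : primorial n ≤ (Δ_[1] ^[n] a 0).natAbs :=
      Nat.le_of_dvd (Int.natAbs_pos.2 hne) (ha.primorial_dvd_natAbs_fwdDiff_iter n 0)
    have h2 : ((primorial n : ℕ) : ℝ) ≤ (((Δ_[1] ^[n] a 0).natAbs : ℕ) : ℝ) := by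
      exact_mod_cast h1
    rw [Nat.cast_natAbs, Int.cast_abs] at h2
    linarith [hb n, hN n hn]
  -- conclusion: `a` is a polynomial
  exact exists_ratPolynomial_of_fwdDiff_iter_eq_zero a N hzero

end Literature.NumberTheory.DiophantineApproximation
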